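import Summits.AnomalousDissipation.AnomalousDissipation.Theorems.SawtoothPulseCascadeK1LocalisedCascadeWienerCarlson

/-!
# K1loc, line `Spectral` / SeqCone — helper: WIENER MOMENTS OF AN AXIS CUT-OFF FROM TWO DERIVATIVE ENERGIES (S-B tool)

Helper file of the prover lane on the crux `K1LocalisedCascade` (stmt-AnomalousDissipation-19491), route
`SawtoothPulseCascade` (memo v7 §3).  Every commutator / insertion / cross-term constant in the energy ledger
(`…EnergyStepH/V.energy_ledger_step_H/_V`: the hypotheses `hωs`, `hω2p`, `hω2s`) is a moment
`Σ_n ω(n) ‖𝓕X(n)‖` of the spectrum of a cut-off `X` that depends on ONE coordinate `x_j`, against a modulus `ω` of the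
symbol which, for symbols smooth at scale `Δk` along `k_j`, satisfies `ω(n) ≤ L·|n_j|` (`L ≈ 1/Δk`).  This file turns such
moments into DERIVATIVE ENERGIES of the cut-off with the sharp `1/ℓ` scaling (Carlson, `…WienerCarlson`):

* `tsum_moment_le_of_axis` — if `𝓕X` is supported on the `j`-axis, `𝓕X₁(n) = 2πi n_j 𝓕X(n)`, `𝓕X₂(n) = 2πi n_j 𝓕X₁(n)`
  (the first two `x_j`-derivatives), `0 ≤ ω(n) ≤ L|n_j|`, then for every integer `Q ≥ 1`
  `Σ_n ω(n)‖𝓕X(n)‖ ≤ (L/2π)·(√(2Q)·√(∫‖X₁‖²) + √(∫‖X₂‖²)/(π√(2Q)))`  (and the moment series is summable).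
  For a `1/N`-periodic cut-off with `4N` ramps of width `ℓ` and `|X′| ≤ c₁/ℓ`, `|X″| ≤ c₂/ℓ²`, the choice `2Q ≈ ‖X₂‖/(π‖X₁‖)`
  gives `≲ (L/π^{3/2})·2√(N c₁c₂)/ℓ` (memo v7 §3; the consumer supplies `∫‖X₁‖² ≤ c₁²·4N/ℓ`, `∫‖X₂‖² ≤ c₂²·4N/ℓ³`).

WHAT THIS IS NOT: no statement about the cascade or the stub; S-B instantiates `X, X₁, X₂` with the `StripCutoff` /
`AffineProfile` profiles and `L` with the `SymbolCone` data. [cite: Grafakos2014, Prop. 3.1.2 (coefficients of derivatives) and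
Prop. 3.2.7 (3) (Parseval)] [problem: turb]
-/

-- `Summit.<Summit>.<Problem>`: single-conjunct summit, the duplicate namespace segment is deliberate.
set_option linter.dupNamespace false

noncomputable section

namespace Summit.AnomalousDissipation.AnomalousDissipation.Theorems.SawtoothPulseCascade.K1Slot

open MeasureTheory Filter Topology Complex UnitAddTorus
open Literature.Analysis Literature.Analysis.FunctionSpaces Literature.Analysis.FunctionSpaces.Torus

variable {d : Type*} [Fintype d] [DecidableEq d]

/-- **Wiener moments of an axis cut-off.**  Let `X, X₁, X₂ : T^d → ℂ` be continuous with `𝓕X` supported on the `j`-axis,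
`𝓕X₁(n) = 2πi n_j · 𝓕X(n)` and `𝓕X₂(n) = 2πi n_j · 𝓕X₁(n)` for all `n`, and let `0 ≤ ω(n) ≤ L·|n_j|`.  Then for every
integer `Q ≥ 1` the moment series is summable and
`Σ_n ω(n)‖𝓕X(n)‖ ≤ (L/(2π))·(√(2Q)·√(∫‖X₁‖²) + √(∫‖X₂‖²)/(π·√(2Q)))`.
[cite: Grafakos2014, Prop. 3.1.2 and Prop. 3.2.7 (3)] -/
theorem tsum_moment_le_of_axis {X X₁ X₂ : UnitAddTorus d → ℂ} (hX₁ : Continuous X₁) (hX₂ : Continuous X₂) (j : d)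
    (hsupp : ∀ n : d → ℤ, mFourierCoeff X n ≠ 0 → ∀ l, l ≠ j → n l = 0)
    (h1 : ∀ n : d → ℤ, mFourierCoeff X₁ n = (2 * Real.pi * Complex.I * (n j)) * mFourierCoeff X n)
    (h2 : ∀ n : d → ℤ, mFourierCoeff X₂ n = (2 * Real.pi * Complex.I * (n j)) * mFourierCoeff X₁ n)
    {ω : (d → ℤ) → ℝ} {L : ℝ} (hL : 0 ≤ L) (hω0 : ∀ n, 0 ≤ ω n) (hω : ∀ n, ω n ≤ L * |((n j : ℤ) : ℝ)|)
    {Q : ℕ} (hQ : 1 ≤ Q) :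
    (Summable fun n => ω n * ‖mFourierCoeff X n‖) ∧
      ∑' n, ω n * ‖mFourierCoeff X n‖ ≤
        L / (2 * Real.pi) * (Real.sqrt (2 * Q) * Real.sqrt (∫ x, ‖X₁ x‖ ^ 2) +
          Real.sqrt (∫ x, ‖X₂ x‖ ^ 2) / (Real.pi * Real.sqrt (2 * Q))) := by
  have hπ : 0 < Real.pi := Real.pi_pos
  -- the axis sequences
  set c : ℤ → ℂ := fun q => mFourierCoeff X₁ (Pi.single j q) with hc_def
  set D : ℤ → ℂ := fun q => mFourierCoeff X₂ (Pi.single j q) with hD_def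
  have hinj : Function.Injective (fun q : ℤ => (Pi.single j q : d → ℤ)) := by
    intro a b h
    have := congr_fun h j
    simpa using this
  have hDq : ∀ q : ℤ, D q = (2 * Real.pi * Complex.I * q) * c q := fun q => by
    simp only [hD_def, hc_def, h2, Pi.single_eq_same]
  -- Parseval on the axis: `Σ|c|² ≤ ∫|X₁|²`, `Σ|D|² ≤ ∫|X₂|²`
  have hP1 := hasSum_sq_mFourierCoeff_of_continuous hX₁
  have hP2 := hasSum_sq_mFourierCoeff_of_continuous hX₂
  have hc2 : Summable (fun q => ‖c q‖ ^ 2) ∧ ∑' q, ‖c q‖ ^ 2 ≤ ∫ x, ‖X₁ x‖ ^ 2 := by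
    have hs : Summable ((fun n => ‖mFourierCoeff X₁ n‖ ^ 2) ∘ fun q : ℤ => (Pi.single j q : d → ℤ)) :=
      hP1.summable.comp_injective hinj
    refine ⟨hs, ?_⟩
    rw [← hP1.tsum_eq]
    exact tsum_comp_le_tsum_of_inj hP1.summable (fun n => sq_nonneg _) hinj
  have hD2 : Summable (fun q => ‖D q‖ ^ 2) ∧ ∑' q, ‖D q‖ ^ 2 ≤ ∫ x, ‖X₂ x‖ ^ 2 := by
    have hs : Summable ((fun n => ‖mFourierCoeff X₂ n‖ ^ 2) ∘ fun q : ℤ => (Pi.single j q : d → ℤ)) :=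
      hP2.summable.comp_injective hinj
    refine ⟨hs, ?_⟩
    rw [← hP2.tsum_eq]
    exact tsum_comp_le_tsum_of_inj hP2.summable (fun n => sq_nonneg _) hinj
  -- Carlson
  obtain ⟨hcs, hcarl⟩ := tsum_norm_le_sqrt_mul_add hc2.1 hD2.1 hDq hQ
  -- the moment sequence on the axis is dominated by `(L/2π)‖c q‖` (and vanishes at `q = 0`)
  set f : (d → ℤ) → ℝ := fun n => ω n * ‖mFourierCoeff X n‖ with hf_def
  have hf_axis : ∀ q : ℤ, f (Pi.single j q) ≤ L / (2 * Real.pi) * (if q = 0 then 0 else ‖c q‖) := by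
    intro q
    simp only [hf_def]
    by_cases hq : q = 0
    · rw [hq, if_pos rfl, mul_zero]
      have : ω (Pi.single j (0 : ℤ)) ≤ 0 := by
        have h := hω (Pi.single j (0 : ℤ))
        rw [Pi.single_eq_same] at h
        simpa using h
      have h0 : ω (Pi.single j (0 : ℤ)) = 0 := le_antisymm this (hω0 _)
      rw [h0, zero_mul]
    · rw [if_neg hq]
      have hq' : (2 * Real.pi * |(q : ℝ)|) ≠ 0 := by
        have : (q : ℝ) ≠ 0 := by exact_mod_cast hq
        positivity
      -- `‖𝓕X(q e_j)‖ = ‖c q‖ / (2π|q|)`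
      have hX : ‖mFourierCoeff X (Pi.single j q)‖ = ‖c q‖ / (2 * Real.pi * |(q : ℝ)|) := by
        have e := h1 (Pi.single j q)
        simp only [Pi.single_eq_same] at e
        rw [hc_def]; simp only []
        rw [e, norm_mul]
        have en : ‖(2 * Real.pi * Complex.I * q : ℂ)‖ = 2 * Real.pi * |(q : ℝ)| := by
          have e1 : (2 * Real.pi * Complex.I * q : ℂ) = ((2 * Real.pi * (q : ℝ) : ℝ) : ℂ) * Complex.I := by
            push_cast; try ring
          rw [e1, norm_mul, Complex.norm_I, mul_one, Complex.norm_real, Real.norm_eq_abs, abs_mul,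
            abs_of_pos (by positivity : (0 : ℝ) < 2 * Real.pi)]
        rw [en]; field_simp
      rw [hX]
      have hωq : ω (Pi.single j q) ≤ L * |(q : ℝ)| := by have h := hω (Pi.single j q); simpa using h
      have hcq : 0 ≤ ‖c q‖ := norm_nonneg _
      calc ω (Pi.single j q) * (‖c q‖ / (2 * Real.pi * |(q : ℝ)|))
          ≤ (L * |(q : ℝ)|) * (‖c q‖ / (2 * Real.pi * |(q : ℝ)|)) :=
            mul_le_mul_of_nonneg_right hωq (by positivity)
        _ = L / (2 * Real.pi) * ‖c q‖ := by field_simp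
  -- `f` vanishes off the axis
  have hf_off : ∀ n : d → ℤ, n ∉ Set.range (fun q : ℤ => (Pi.single j q : d → ℤ)) → f n = 0 := by
    intro n hn
    simp only [hf_def]
    by_cases hz : mFourierCoeff X n = 0
    · rw [hz, norm_zero, mul_zero]
    · exfalso; apply hn
      refine ⟨n j, ?_⟩
      show (Pi.single j (n j) : d → ℤ) = n
      funext l
      by_cases hl : l = j
      · subst hl; simp
      · rw [Pi.single_eq_of_ne hl, hsupp n hz l hl]
  -- summability of `f` via the axis
  have hg : Summable fun q : ℤ => L / (2 * Real.pi) * (if q = 0 then 0 else ‖c q‖) := by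
    refine Summable.mul_left _ ?_
    exact (hcs.of_nonneg_of_le (fun q => by split_ifs <;> positivity) fun q => by split_ifs <;> simp)
  have hf_nn : ∀ n, 0 ≤ f n := fun n => mul_nonneg (hω0 n) (norm_nonneg _)
  have hf_comp : Summable (f ∘ fun q : ℤ => (Pi.single j q : d → ℤ)) :=
    hg.of_nonneg_of_le (fun q => hf_nn _) hf_axis
  have hfs : Summable f := (Function.Injective.summable_iff hinj hf_off).mp hf_comp
  refine ⟨hfs, ?_⟩
  have heq : ∑' n, f n = ∑' q : ℤ, f (Pi.single j q) :=
    (Function.Injective.tsum_eq hinj (f := f) (fun n hn => by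
      by_contra h; exact hn (hf_off n h))).symm
  rw [heq]
  calc ∑' q : ℤ, f (Pi.single j q) ≤ ∑' q : ℤ, L / (2 * Real.pi) * (if q = 0 then 0 else ‖c q‖) :=
        hf_comp.tsum_le_tsum hf_axis hg
    _ = L / (2 * Real.pi) * ∑' q : ℤ, (if q = 0 then 0 else ‖c q‖) := tsum_mul_left
    _ ≤ L / (2 * Real.pi) * (Real.sqrt (2 * Q) * Real.sqrt (∑' q, ‖c q‖ ^ 2) +
          Real.sqrt (∑' q, ‖D q‖ ^ 2) / (Real.pi * Real.sqrt (2 * Q))) :=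
        mul_le_mul_of_nonneg_left hcarl (by positivity)
    _ ≤ L / (2 * Real.pi) * (Real.sqrt (2 * Q) * Real.sqrt (∫ x, ‖X₁ x‖ ^ 2) +
          Real.sqrt (∫ x, ‖X₂ x‖ ^ 2) / (Real.pi * Real.sqrt (2 * Q))) := by
        refine mul_le_mul_of_nonneg_left (add_le_add ?_ ?_) (by positivity)
        · exact mul_le_mul_of_nonneg_left (Real.sqrt_le_sqrt hc2.2) (Real.sqrt_nonneg _)
        · exact div_le_div_of_nonneg_right (Real.sqrt_le_sqrt hD2.2) (by positivity)

end Summit.AnomalousDissipation.AnomalousDissipation.Theorems.SawtoothPulseCascade.K1Slot
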